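import Literature.NumberTheory.Transcendental.ExpPointsExamples
import Mathlib.RingTheory.KrullDimension.Basic
import HarnessLib

/-!
# Permuting coordinates: `ℚ`-definedness, Zariski dimension, independent exponential points

Topic `Literature/NumberTheory/Transcendental`. For a permutation `τ` of the index set, the
coordinate change `W ↦ W^τ = {z | z ∘ τ ∈ W}` preserves being defined over a subfield
(`isDefinedOver_comp_equiv`: rename the variables in the defining ideal) and the Zariski dimension
(`zariskiDim_comp_equiv`: the coordinate rings are isomorphic under `rename`). For `W ⊆ ℂ² × ℂ²`
and the simultaneous swap of both blocks, `x` is an independent exponential point of `W^τ` iff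
`x ∘ swap` is one of `W` (`mem_indepExpPoints_comp_swap`). Used to reduce statements about a
distinguished coordinate to the first one. PROVED, no definition. [folklore]
-/

noncomputable section

open MvPolynomial

namespace Literature.NumberTheory.Transcendental

variable {K : Type*} [Field K] {ι : Type*}

/-- **Renaming variables preserves `F`-definedness**: `{z | z ∘ τ ∈ Z(I)} = Z(rename τ · I)`.
[folklore] -/
theorem isDefinedOver_comp_equiv {F : Subfield K} {S : Set (ι → K)} (h : IsDefinedOver F S)
    (τ : ι ≃ ι) : IsDefinedOver F {z : ι → K | z ∘ τ ∈ S} := by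
  obtain ⟨I, rfl⟩ := h
  refine ⟨I.map (MvPolynomial.rename τ : MvPolynomial ι F →ₐ[F] MvPolynomial ι F), ?_⟩
  ext z
  simp only [Set.mem_setOf_eq, MvPolynomial.mem_zeroLocus_iff]
  constructor
  · intro hz p hp
    have hker : I.map (MvPolynomial.rename τ : MvPolynomial ι F →ₐ[F] MvPolynomial ι F) ≤
        RingHom.ker (MvPolynomial.aeval z : MvPolynomial ι F →ₐ[F] K) := by
      rw [Ideal.map_le_iff_le_comap]
      intro q hq
      rw [Ideal.mem_comap, RingHom.mem_ker]
      show MvPolynomial.aeval z (MvPolynomial.rename τ q) = 0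
      rw [MvPolynomial.aeval_rename]
      exact hz q hq
    exact hker hp
  · intro hz p hp
    have := hz (MvPolynomial.rename τ p) (Ideal.mem_map_of_mem _ hp)
    rwa [MvPolynomial.aeval_rename] at this

/-- **Renaming variables preserves the Zariski dimension.** [folklore] -/
theorem zariskiDim_comp_equiv (S : Set (ι → K)) (τ : ι ≃ ι) :
    zariskiDim K {z : ι → K | z ∘ τ ∈ S} = zariskiDim K S := by
  unfold zariskiDim
  set g : MvPolynomial ι K ≃+* MvPolynomial ι K := (MvPolynomial.renameEquiv K τ.symm).toRingEquiv
    with hg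
  have hcomap : MvPolynomial.vanishingIdeal K {z : ι → K | z ∘ τ ∈ S} =
      (MvPolynomial.vanishingIdeal K S).comap (g : MvPolynomial ι K →+* MvPolynomial ι K) := by
    ext p
    simp only [MvPolynomial.mem_vanishingIdeal_iff, Set.mem_setOf_eq, Ideal.mem_comap,
      RingEquiv.coe_toRingHom, hg, AlgEquiv.coe_ringEquiv,
      MvPolynomial.renameEquiv_apply, MvPolynomial.aeval_rename]
    constructor
    · intro h x hx
      exact h (x ∘ τ.symm) (by simpa [Function.comp_assoc] using hx)
    · intro h z hz
      have := h (z ∘ τ) hz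
      simpa [Function.comp_assoc] using this
  rw [hcomap]
  refine ringKrullDim_eq_of_ringEquiv (Ideal.quotientEquiv _ _ g ?_)
  exact (Ideal.map_comap_of_surjective _ g.surjective _).symm

/-- `Sum.elim` and a simultaneous permutation of both blocks. [folklore] -/
theorem sumElim_comp_sumCongr {α β γ : Type*} (f : α → γ) (g : β → γ) (σ : α ≃ α) (σ' : β ≃ β) :
    Sum.elim f g ∘ ⇑(Equiv.sumCongr σ σ') = Sum.elim (f ∘ σ) (g ∘ σ') := by
  funext k
  rcases k with k | k <;> simp

/-- **Independent exponential points under the swap of coordinates.** [folklore] -/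
theorem mem_indepExpPoints_comp_swap {W : Set (Fin 2 ⊕ Fin 2 → ℂ)} (σ : Fin 2 ≃ Fin 2)
    {x : Fin 2 → ℂ} :
    x ∈ indepExpPoints {z : Fin 2 ⊕ Fin 2 → ℂ | z ∘ ⇑(Equiv.sumCongr σ σ) ∈ W} ↔
      x ∘ σ ∈ indepExpPoints W := by
  rw [mem_indepExpPoints_iff, mem_indepExpPoints_iff, Set.mem_setOf_eq, sumElim_comp_sumCongr,
    linearIndependent_equiv σ, Function.comp_assoc]

end Literature.NumberTheory.Transcendental

end
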